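import Summits.ValiantsHypothesis.ValiantsHypothesis.Theorems.BarrierLeverPartitionMinorsHitByVPHiddenStatesBallCutFree

/-!
# Route BarrierLever — item `PartitionMinorsHitByVP` (stmt-ValiantsHypothesis-19717), line `hidden-states`:
# THE JD TABLE — one explicit table for the whole m-th shell, and CONJECTURE JD (typed, NOT asserted)

Helper file (`--supports stmt-ValiantsHypothesis-19717`; cell valiant-natproofs, 𝒟-side door (c), registered line
`Cruxes/PartitionMinorsHitByVP/Lines/hidden_states.lean` v10; prover seat val-np-p6 gen 22; planner SUCCESSOR MANDATE STATUS l.1830 (P1):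
«the STRUCTURAL CELL … an explicit ∀-construction of mixing tables replacing per-core certificates»).  Closes NO item; `Stmt.conjJD` is a
`def … : Prop`, NOT asserted; the two theorems are the kernel arrows from it.

THE TABLE (memo HOME/val-np-p6/g22/MEMO-valnp6-g22.md §2–§4).  Base point `0`; state `q` is read by coordinate `a` with weight
`1 + [q = a]·w_a` (`jdTable w` = all-ones + a generic diagonal).  Then column `J` of the ball sits at the point `x_J(a) = |J| + w_a·[a ∈ J]`
(`jdTable_point`) and the column's standard-form matrix is `jdMatrix w u cols`, entry `∏_{a ∈ u i} (|cols k| + [a ∈ cols k]·w_a)`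
(`matrix_jdTable_eq`).

CONJECTURE JD(t, m) (`Stmt.conjJD t m`): for every `n`, every family `B_t(n) ∖ {A_l} ∪ {C_l}` (`A_l` distinct `t`-sets, `C_l` distinct
`(t+1)`-sets, `l < m`) in standard form has weights `w` with `det (jdMatrix w u cols) ≠ 0`.  ARROWS: `exists_table_of_conjJD` (JD(t,m) ⇒ every
m-swap family at level `t` is served, standard form) — in particular **JD(t,3) is the whole THIRD SHELL `S₃` at level `t`, for every `h`, by
ONE table** (no reduction to cores, no certificates).

EVIDENCE (kit j332673–j332802, auto-evidence on 19717; arithmetic mod 65521 at random `w`, zeros re-tested): EXHAUSTIVE `(t,n,m)` =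
(3,6,2) 19 950 · (3,6,3) 518 700 · (3,6,4) 6 613 425 · (3,7,2) 354 025; every A- resp. every C-configuration of (3,7,3) × 10 partners
(2 × 523 600); random (3,7,3) 400k, (3,8,3) 200k, (3,7,4) 500k, (3,7,5) 300k, (3,8,5) 150k, (3,8,7) 100k, (3,9,4) 60k, (4,9,3) 40k, (4,10,4) 15k:
ZERO structural failures; all 61 cores of the t = 3 chart are served by it.  LIMITS (memo §4): JD(2,3) is FALSE (480/518 700 families at
n = 6, e.g. `A = {01,02,12}`, `C = {034,035,045}`), and JD(t, m) is FALSE for large `m` by the TWIN OBSTRUCTION (paper theorem: coordinates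
`x, y ∉ ⋃ C_l` with `#{R : xR, yR ∈ A} + #{R : xyR ∈ A} > C(n-2, t-2)` force an `(x y)`-antisymmetric kernel vector; needs
`m > C(n-2,t-2) ≥ C(t+1,3)`, confirmed at `t = 3, n = 8, m = 8`).  The conjecture of record is therefore JD(t, 3) for `t ≥ 3` (and plausibly
JD(t, m) for `m ≤ C(t+1, 3)`).  ALGEBRA (memo §3): `det (jdMatrix) = (∏_{d<t} det Q_d) · det H` with
`H[U,X] = Σ_{S ⊆ U∩X} (t-|S|)! w^S` (t-rows), `H[C,X] = Σ_{S ⊆ C∩X, |S| ≤ t} (t+1-|S|)!(t+|S|)/2 · w^S` (C-rows), columns the `t`-sets.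

HONEST LABEL: a typed conjecture with its two trivial arrows; 19717 stays OPEN; nothing on crux 14610 or VP ≠ VNP.
-/

set_option linter.dupNamespace false

namespace Summit.ValiantsHypothesis.ValiantsHypothesis.Theorems.BarrierLever.HiddenStates

open Finset

noncomputable section

namespace BallCut

open SymbJoin

/-! ## 1. The JD table -/

/-- **The JD table** at weights `w`: base point `0`; state `q` is read by coordinate `a` with weight `1 + [q = a]·w a`
(all-ones plus the diagonal `w`). -/
def jdTable {h : ℕ} (w : Fin h → ℂ) : Option (Fin h) → Fin h → ℂ :=
  fun o a => Option.elim o 0 fun q => 1 + if q = a then w a else 0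

/-- The point of column `J` under the JD table: coordinate `a` reads `|J| + [a ∈ J]·w a`. -/
theorem jdTable_point {h : ℕ} (w : Fin h → ℂ) (J : Finset (Fin h)) (a : Fin h) :
    jdTable w none a + ∑ q ∈ J, jdTable w (some q) a = (J.card : ℂ) + if a ∈ J then w a else 0 := by
  simp only [jdTable, Option.elim, zero_add, Finset.sum_add_distrib, Finset.sum_const, nsmul_eq_mul, mul_one]
  rw [Finset.sum_ite_eq' J a (fun _ => w a)]

/-- **The JD matrix** of a row list `u` and a column list `cols` at weights `w`: entry `∏_{a ∈ u i} (|cols k| + [a ∈ cols k]·w a)`. -/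
def jdMatrix {h r : ℕ} (w : Fin h → ℂ) (u cols : Fin r → Finset (Fin h)) : Matrix (Fin r) (Fin r) ℂ :=
  Matrix.of fun i k => ∏ a ∈ u i, (((cols k).card : ℂ) + if a ∈ cols k then w a else 0)

/-- The column's standard-form matrix at the JD table IS the JD matrix. -/
theorem matrix_jdTable_eq {h r : ℕ} (w : Fin h → ℂ) (u cols : Fin r → Finset (Fin h)) :
    (Matrix.of fun i k : Fin r => ∏ a ∈ u i, (jdTable w none a + ∑ q ∈ cols k, jdTable w (some q) a)) = jdMatrix w u cols := by
  ext i k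
  simp only [jdMatrix, Matrix.of_apply, jdTable_point]

/-! ## 2. Conjecture JD (typed, NOT asserted) and its arrows -/

/-- **CONJECTURE JD(t, m)** (val-np-p6 g22; NOT asserted — a `Prop`): every m-swap family `B_t(n) ∖ {A_l} ∪ {C_l}` of the ball `B_t(n)`
(`A_l` distinct `t`-sets, `C_l` distinct `(t+1)`-sets), in the column's standard form (`u` injective onto the family, `cols` onto the ball),
has weights `w` at which the JD matrix is nonsingular.  Evidence and known limits (false at `(t,m) = (2,3)`; false for `m > C(n-2,t-2)` by the
twin obstruction): see the module docstring.  The conjecture of record is `conjJD t 3` for `t ≥ 3`. -/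
def Stmt.conjJD (t m : ℕ) : Prop :=
  ∀ (n : ℕ) (A C : Fin m → Finset (Fin n)), (∀ l, (A l).card = t) → (∀ l, (C l).card = t + 1) →
    Function.Injective A → Function.Injective C →
    ∀ ⦃r : ℕ⦄ (u cols : Fin r → Finset (Fin n)), Function.Injective u →
      (∀ i, ((u i).card ≤ t ∧ ∀ l, u i ≠ A l) ∨ ∃ l, u i = C l) →
      (∀ J : Finset (Fin n), J.card ≤ t → ∃ k, cols k = J) →
      ∃ w : Fin n → ℂ, (jdMatrix w u cols).det ≠ 0

/-- ★ **ARROW: JD(t, m) ⇒ every m-swap family at level `t` is served** (standard form; the table is `jdTable w`). -/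
theorem exists_table_of_conjJD {t m : ℕ} (hJD : Stmt.conjJD t m) (n : ℕ) (A C : Fin m → Finset (Fin n))
    (hA : ∀ l, (A l).card = t) (hC : ∀ l, (C l).card = t + 1)
    (hAi : Function.Injective A) (hCi : Function.Injective C)
    {r : ℕ} (u cols : Fin r → Finset (Fin n)) (hu : Function.Injective u)
    (hU : ∀ i, ((u i).card ≤ t ∧ ∀ l, u i ≠ A l) ∨ ∃ l, u i = C l)
    (hcols : ∀ J : Finset (Fin n), J.card ≤ t → ∃ k, cols k = J) :
    ∃ tx : Option (Fin n) → Fin n → ℂ,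
      (Matrix.of fun i k : Fin r => ∏ a ∈ u i, (tx none a + ∑ q ∈ cols k, tx (some q) a)).det ≠ 0 := by
  obtain ⟨w, hw⟩ := hJD n A C hA hC hAi hCi u cols hu hU hcols
  exact ⟨jdTable w, by rw [matrix_jdTable_eq]; exact hw⟩

/-- ★ **ARROW, every `h`**: JD(t, m) ⇒ the class of (`A`, `C`) on `Fin n` is served on `Fin h` along any `σ : Fin n ↪ Fin h`
(the conjecture is applied at `h` to the transported family — JD tables need no free-coordinate theorem). -/
theorem exists_table_map_of_conjJD {t m : ℕ} (hJD : Stmt.conjJD t m) (n : ℕ) {h : ℕ} (σ : Fin n ↪ Fin h)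
    (A C : Fin m → Finset (Fin n))
    (hA : ∀ l, (A l).card = t) (hC : ∀ l, (C l).card = t + 1)
    (hAi : Function.Injective A) (hCi : Function.Injective C)
    {r : ℕ} (u cols : Fin r → Finset (Fin h)) (hu : Function.Injective u)
    (hU : ∀ i, ((u i).card ≤ t ∧ ∀ l, u i ≠ (A l).map σ) ∨ ∃ l, u i = (C l).map σ)
    (hcols : ∀ J : Finset (Fin h), J.card ≤ t → ∃ k, cols k = J) :
    ∃ tx : Option (Fin h) → Fin h → ℂ,
      (Matrix.of fun i k : Fin r => ∏ a ∈ u i, (tx none a + ∑ q ∈ cols k, tx (some q) a)).det ≠ 0 :=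
  exists_table_of_conjJD hJD h (fun l => (A l).map σ) (fun l => (C l).map σ)
    (fun l => by rw [Finset.card_map, hA]) (fun l => by rw [Finset.card_map, hC])
    (fun l l' hll' => hAi (Finset.map_injective σ hll')) (fun l l' hll' => hCi (Finset.map_injective σ hll'))
    u cols hu hU hcols

/-- The JD table with NATURAL weights is an instance of the certificate kit's integer tables: `T q a = 1 + [q = a]·w a`; so single
instances of `Stmt.conjJD` are certifiable by `exists_table_of_packCert` (`…BallCutCertKit`) with this `T`. -/
def jdNatTable {n : ℕ} (w : Fin n → ℕ) (q a : Fin n) : ℕ := 1 + if q = a then w a else 0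

/-- The natural JD table read as a complex table is `jdTable`. -/
theorem jdTable_natCast {n : ℕ} (w : Fin n → ℕ) (q a : Fin n) :
    ((jdNatTable w q a : ℕ) : ℂ) = jdTable (fun a => (w a : ℂ)) (some q) a := by
  by_cases hq : q = a <;> simp [jdNatTable, jdTable, hq]

/-! ## 3. The JD⁺ table (diagonal plus rank one) and CONJECTURE DS (down-sets), appended by val-np-p6 g22 (same seat)

Memo HOME/val-np-p6/g22/MEMO-valnp6-g22.md §4b.  The JD table is singular at `t ≤ 2` on «far» configurations (three `C`'s disjoint from
three `A`'s) by a FAR-FIELD RANK obstruction (Woodbury core of `H_full` is diagonal + rank ≤ 2 at `t ≤ 2`; the far coupling `q_{C_l}(A_j)` has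
rank 2 at `t = 1`, rank 1 at `t = 2`), and for large `m` by the twin obstruction; the two-weight table below has no twin obstruction and the
same far-field rank as JD, so its conjecture is stated for `t ≥ 3`, where no obstruction survives generic weights (censuses: memo §2/§4b). -/

/-- **The JD⁺ table** at weights `u, w`: base point `0`; state `q` is read by coordinate `a` with weight `u q + [q = a]·w a`; column `J` sits at
`x_J(a) = u(J) + [a ∈ J]·w a` (`u(J) = Σ_{q ∈ J} u q`): the points are the linear image `(diag w + 𝟙 uᵀ) 1_J` of the Boolean ball. -/
def jdPlusTable {h : ℕ} (u w : Fin h → ℂ) : Option (Fin h) → Fin h → ℂ :=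
  fun o a => Option.elim o 0 fun q => u q + if q = a then w a else 0

/-- The point of column `J` under the JD⁺ table. -/
theorem jdPlusTable_point {h : ℕ} (u w : Fin h → ℂ) (J : Finset (Fin h)) (a : Fin h) :
    jdPlusTable u w none a + ∑ q ∈ J, jdPlusTable u w (some q) a = (∑ q ∈ J, u q) + if a ∈ J then w a else 0 := by
  simp only [jdPlusTable, Option.elim, zero_add, Finset.sum_add_distrib]
  rw [Finset.sum_ite_eq' J a (fun _ => w a)]

/-- **The JD⁺ matrix** of a row list `u₀` and a column list `cols` at weights `u, w`: entry `∏_{a ∈ u₀ i} (u(cols k) + [a ∈ cols k]·w a)`. -/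
def jdPlusMatrix {h r : ℕ} (u w : Fin h → ℂ) (u₀ cols : Fin r → Finset (Fin h)) : Matrix (Fin r) (Fin r) ℂ :=
  Matrix.of fun i k => ∏ a ∈ u₀ i, ((∑ q ∈ cols k, u q) + if a ∈ cols k then w a else 0)

/-- The column's standard-form matrix at the JD⁺ table IS the JD⁺ matrix. -/
theorem matrix_jdPlusTable_eq {h r : ℕ} (u w : Fin h → ℂ) (u₀ cols : Fin r → Finset (Fin h)) :
    (Matrix.of fun i k : Fin r => ∏ a ∈ u₀ i, (jdPlusTable u w none a + ∑ q ∈ cols k, jdPlusTable u w (some q) a))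
      = jdPlusMatrix u w u₀ cols := by
  ext i k
  simp only [jdPlusMatrix, Matrix.of_apply, jdPlusTable_point]

/-- **CONJECTURE DS(t)** (val-np-p6 g22; NOT asserted — a `Prop`): every DOWN-SET `𝒟 ⊆ 2^{Fin n}` with `|𝒟| = |B_t(n)|`, in standard
form (`u₀` injective onto `𝒟`, `cols` onto the ball `B_t(n)`), has weights `u, w` at which the JD⁺ matrix is nonsingular.  The conjecture
of record is `conjDS t` for `t ≥ 3` (false at `t ≤ 2` by the far-field obstruction of the module docstring of §3; numerically true at `t = 2`
only for `n ≤ 7`).  It is the `w = ball` case of val-np-p1's lower-pair conjectures on item 22510 (`Stmt.conjEvalCube` / U1), with an explicit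
door.  EVIDENCE (memo §4b; lab/downset.py, lab tests, kit census modes `ds` / `JDB` / `R1c`): at `t = 3, 4` random down-sets by cover moves
from the ball and cube-heavy down-sets (`2^[6]` versus `B_3(7)`, `2^[5]` + cone versus `B_3(6)`), the far swap families with `m ≤ 6`
(`n ≤ 15`), the JD twin family (`t = 3, n = 8, m = 8`) and every swap-family census of the module docstring: zero failures.  WHY IT MIGHT FAIL:
a down-set whose JD⁺ evaluation matrix is identically singular by a third mechanism (neither twin nor far-field) — none seen at `t ≥ 3`. -/
def Stmt.conjDS (t : ℕ) : Prop :=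
  ∀ (n : ℕ) ⦃r : ℕ⦄ (u₀ cols : Fin r → Finset (Fin n)), Function.Injective u₀ → IsLowerSet (Set.range u₀) →
    Function.Injective cols → (∀ J : Finset (Fin n), (∃ k, cols k = J) ↔ J.card ≤ t) →
    ∃ u w : Fin n → ℂ, (jdPlusMatrix u w u₀ cols).det ≠ 0

/-- ★ **ARROW: DS(t) ⇒ every down-closed swap family at level `t` is served** (no `A_l ⊆ C_{l'}`; the hypothesis `hAC` of the column's
reduction theorems): the family `B_t(n) ∖ {A_l} ∪ {C_l}` is then a down-set of size `|B_t(n)|` (`rigidity`), so `conjDS t` applies. -/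
theorem exists_table_of_conjDS {t : ℕ} (hDS : Stmt.conjDS t) (n : ℕ) {m : ℕ} (A C : Fin m → Finset (Fin n))
    (hA : ∀ l, (A l).card = t) (hC : ∀ l, (C l).card = t + 1)
    (hAi : Function.Injective A) (hCi : Function.Injective C) (hAC : ∀ l l', ¬ A l ⊆ C l')
    {r : ℕ} (u₀ cols : Fin r → Finset (Fin n)) (hu : Function.Injective u₀)
    (hU : ∀ i, ((u₀ i).card ≤ t ∧ ∀ l, u₀ i ≠ A l) ∨ ∃ l, u₀ i = C l)
    (hcols : ∀ J : Finset (Fin n), J.card ≤ t → ∃ k, cols k = J) :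
    ∃ tx : Option (Fin n) → Fin n → ℂ,
      (Matrix.of fun i k : Fin r => ∏ a ∈ u₀ i, (tx none a + ∑ q ∈ cols k, tx (some q) a)).det ≠ 0 := by
  classical
  obtain ⟨hcinj, hUr, hJr⟩ := rigidity t A C hA hC hAi hCi u₀ cols hu hU hcols
  -- the swap family is a down-set
  have hlow : IsLowerSet (Set.range u₀) := by
    intro U V hVU hUmem
    obtain ⟨i, rfl⟩ := hUmem
    have hV : V ⊆ u₀ i := hVU
    rw [Set.mem_range, hUr V]
    rcases hU i with ⟨hcard, hne⟩ | ⟨l, hl⟩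
    · -- `V ⊆ u₀ i`, `|u₀ i| ≤ t`: `V` is in the ball; it is not an `A` unless it equals `u₀ i`... but `|A| = t ≥ |V|`
      by_cases hVA : ∃ l, V = A l
      · obtain ⟨l, rfl⟩ := hVA
        -- `A l ⊆ u₀ i` with `|u₀ i| ≤ t = |A l|` forces `u₀ i = A l`, contradiction
        exfalso
        have := Finset.eq_of_subset_of_card_le hV (by rw [hA]; exact hcard)
        exact hne l this.symm
      · exact Or.inl ⟨(Finset.card_le_card hV).trans hcard, fun l hVl => hVA ⟨l, hVl⟩⟩
    · -- `V ⊆ C l`: either `V = C l` or `|V| ≤ t`, and `V` is no `A` (by `hAC`) unless ... `A l' ⊆ C l` is excluded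
      by_cases hVC : V = C l
      · exact Or.inr ⟨l, hVC⟩
      · have hVC' : V ⊆ C l := hl ▸ hV
        have hVlt : V.card < (C l).card := Finset.card_lt_card (lt_of_le_of_ne hVC' hVC)
        refine Or.inl ⟨by rw [hC] at hVlt; omega, fun l' hVA => hAC l' l ?_⟩
        rw [← hVA]; exact hVC'
  obtain ⟨u, w, huw⟩ := hDS n u₀ cols hu hlow hcinj hJr
  exact ⟨jdPlusTable u w, by rw [matrix_jdPlusTable_eq]; exact huw⟩

/-! ## 4. CORRECTION (same seat, 40 minutes after §3): `Stmt.conjDS` is FALSE as typed — the CUBE OBSTRUCTION; the conjecture of record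
is `Stmt.conjJDPlus` (swap families)

THE CUBE OBSTRUCTION (paper, counting).  Under the JD⁺ table the point of column `J` restricted to a coordinate set `K` is
`(u(J) + w_a [a ∈ J])_{a ∈ K}`: it depends on `J` only through `(J ∩ K, u(J))`, and for the columns with `J ∩ K = I` fixed the rows
`U ⊆ K` of a sub-down-set `𝒟_K = 𝒟 ∩ 2^K` see only the scalar `s = u(J)` through the polynomials `∏_{a ∈ U} (s + w_a [a ∈ I])` of degree
`≤ max |U|`.  Hence `rank (rows 𝒟_K) ≤ Σ_{I ⊆ K, |I| ≤ t} min(|B_{t-|I|}(n-|K|)|, 1 + max_{U ∈ 𝒟_K} |U|)`, which is `< |𝒟_K|` for a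
down-set containing a large cube `2^K` with many coordinates outside `K`: e.g. `t = 1`, `𝒟 = 2^{[3]}` versus `B_1(7)` (8 × 8: the five
columns `∅, {3}, …, {6}` restricted to `K = [3]` lie in the 4-dimensional span of `(δ_{|U|,d})_{d ≤ 3}`); `t = 2`, `𝒟 ⊇ 2^{[12]}` versus
`B_2(90)`; `t = 3`, `𝒟 = 2^{[11]}` versus `B_3(23)` (the Golay pair: rank ≤ 969 < 2048) and `𝒟 ⊇ 2^{[17]}` inside `B_3(92)`.  So
`Stmt.conjDS t` fails for every `t` (at large `n`); what the censuses support is the conjecture for families of SMALL sets — in particular the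
column's swap families, for which the bound above is never violated.  `exists_table_of_conjDS` stays correct (an arrow from a false
premise); the arrow of record is `exists_table_of_conjJDPlus` below.  (GENERIC tables are not affected: the obstruction is the price of the
rank-one structure `diag(w) + 𝟙 uᵀ`.) -/

/-- **CONJECTURE JD⁺(t, m)** (val-np-p6 g22; NOT asserted — a `Prop`; the conjecture of record of this file for `t ≥ 3`): every
DOWN-CLOSED m-swap family `B_t(n) ∖ {A_l} ∪ {C_l}` (`A_l` distinct `t`-sets, `C_l` distinct `(t+1)`-sets, no `A_l ⊆ C_{l'}` — the
hypothesis `hAC` of the column's reduction theorems), in standard form, has weights `u, w` at which the JD⁺ matrix is nonsingular.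
EVIDENCE: every census of the module docstring and of §3 (t = 3, 4; m ≤ 8; far families; twins) — zero failures; FALSE at `t ≤ 2`
(far-field rank obstruction, §3).  `conjJDPlus t 3` for `t ≥ 3` together with the kernel t ≤ 2 levels would give the whole THIRD SHELL. -/
def Stmt.conjJDPlus (t m : ℕ) : Prop :=
  ∀ (n : ℕ) (A C : Fin m → Finset (Fin n)), (∀ l, (A l).card = t) → (∀ l, (C l).card = t + 1) →
    Function.Injective A → Function.Injective C → (∀ l l', ¬ A l ⊆ C l') →
    ∀ ⦃r : ℕ⦄ (u₀ cols : Fin r → Finset (Fin n)), Function.Injective u₀ →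
      (∀ i, ((u₀ i).card ≤ t ∧ ∀ l, u₀ i ≠ A l) ∨ ∃ l, u₀ i = C l) →
      (∀ J : Finset (Fin n), J.card ≤ t → ∃ k, cols k = J) →
      ∃ u w : Fin n → ℂ, (jdPlusMatrix u w u₀ cols).det ≠ 0

/-- ★ **ARROW: JD⁺(t, m) ⇒ every down-closed m-swap family at level `t` is served** (standard form; table `jdPlusTable u w`). -/
theorem exists_table_of_conjJDPlus {t m : ℕ} (hJ : Stmt.conjJDPlus t m) (n : ℕ) (A C : Fin m → Finset (Fin n))
    (hA : ∀ l, (A l).card = t) (hC : ∀ l, (C l).card = t + 1)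
    (hAi : Function.Injective A) (hCi : Function.Injective C) (hAC : ∀ l l', ¬ A l ⊆ C l')
    {r : ℕ} (u₀ cols : Fin r → Finset (Fin n)) (hu : Function.Injective u₀)
    (hU : ∀ i, ((u₀ i).card ≤ t ∧ ∀ l, u₀ i ≠ A l) ∨ ∃ l, u₀ i = C l)
    (hcols : ∀ J : Finset (Fin n), J.card ≤ t → ∃ k, cols k = J) :
    ∃ tx : Option (Fin n) → Fin n → ℂ,
      (Matrix.of fun i k : Fin r => ∏ a ∈ u₀ i, (tx none a + ∑ q ∈ cols k, tx (some q) a)).det ≠ 0 := by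
  obtain ⟨u, w, huw⟩ := hJ n A C hA hC hAi hCi hAC u₀ cols hu hU hcols
  exact ⟨jdPlusTable u w, by rw [matrix_jdPlusTable_eq]; exact huw⟩

/-- ★ **ARROW, every `h`**: JD⁺(t, m) ⇒ the class of a down-closed (`A`, `C`) on `Fin n` is served on `Fin h` along any `σ : Fin n ↪ Fin h`. -/
theorem exists_table_map_of_conjJDPlus {t m : ℕ} (hJ : Stmt.conjJDPlus t m) (n : ℕ) {h : ℕ} (σ : Fin n ↪ Fin h)
    (A C : Fin m → Finset (Fin n))
    (hA : ∀ l, (A l).card = t) (hC : ∀ l, (C l).card = t + 1)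
    (hAi : Function.Injective A) (hCi : Function.Injective C) (hAC : ∀ l l', ¬ A l ⊆ C l')
    {r : ℕ} (u₀ cols : Fin r → Finset (Fin h)) (hu : Function.Injective u₀)
    (hU : ∀ i, ((u₀ i).card ≤ t ∧ ∀ l, u₀ i ≠ (A l).map σ) ∨ ∃ l, u₀ i = (C l).map σ)
    (hcols : ∀ J : Finset (Fin h), J.card ≤ t → ∃ k, cols k = J) :
    ∃ tx : Option (Fin h) → Fin h → ℂ,
      (Matrix.of fun i k : Fin r => ∏ a ∈ u₀ i, (tx none a + ∑ q ∈ cols k, tx (some q) a)).det ≠ 0 :=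
  exists_table_of_conjJDPlus hJ h (fun l => (A l).map σ) (fun l => (C l).map σ)
    (fun l => by rw [Finset.card_map, hA]) (fun l => by rw [Finset.card_map, hC])
    (fun l l' hll' => hAi (Finset.map_injective σ hll')) (fun l l' hll' => hCi (Finset.map_injective σ hll'))
    (fun l l' hsub => hAC l l' (Finset.map_subset_map.mp hsub)) u₀ cols hu hU hcols

/-- DS(t) would imply JD⁺(t, m) for every `m` (recorded for the registry; DS is false in general, §4 docstring). -/
theorem conjJDPlus_of_conjDS {t : ℕ} (hDS : Stmt.conjDS t) (m : ℕ) : Stmt.conjJDPlus t m := by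
  intro n A C hA hC hAi hCi hAC r u₀ cols hu hU hcols
  classical
  obtain ⟨hcinj, hUr, hJr⟩ := rigidity t A C hA hC hAi hCi u₀ cols hu hU hcols
  have hlow : IsLowerSet (Set.range u₀) := by
    intro U V hVU hUmem
    obtain ⟨i, rfl⟩ := hUmem
    have hV : V ⊆ u₀ i := hVU
    rw [Set.mem_range, hUr V]
    rcases hU i with ⟨hcard, hne⟩ | ⟨l, hl⟩
    · by_cases hVA : ∃ l, V = A l
      · obtain ⟨l, rfl⟩ := hVA
        exfalso
        have := Finset.eq_of_subset_of_card_le hV (by rw [hA]; exact hcard)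
        exact hne l this.symm
      · exact Or.inl ⟨(Finset.card_le_card hV).trans hcard, fun l hVl => hVA ⟨l, hVl⟩⟩
    · by_cases hVC : V = C l
      · exact Or.inr ⟨l, hVC⟩
      · have hVC' : V ⊆ C l := hl ▸ hV
        have hVlt : V.card < (C l).card := Finset.card_lt_card (lt_of_le_of_ne hVC' hVC)
        refine Or.inl ⟨by rw [hC] at hVlt; omega, fun l' hVA => hAC l' l ?_⟩
        rw [← hVA]; exact hVC'
  exact hDS n u₀ cols hu hlow hcinj hJr

/-! ## 5. THE CUBE OBSTRUCTION IN THE KERNEL: `¬ Stmt.conjDS 1` (appended by val-np-p6 g22, same seat)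

The smallest instance of the counting obstruction of §4: the down-set `2^{[3]}` (8 sets) against the ball `B_1(7)` (8 points).  Under ANY
JD⁺ table the five columns `J = ∅, {3}, {4}, {5}, {6}` have entries `u(J)^{|U|}` on the rows `U ⊆ [3]` (no state of `J` is a cube
coordinate), so they lie in the 4-dimensional span of the layer indicators `[|U| = d]`, `d ≤ 3`: the 8 × 8 matrix is singular for all
`u, w` (`not_conjDS_one`).  The same count refutes `conjDS t` for every `t` at large `n` (§4); generic tables are unaffected. -/

/-- The cube `2^{[3]}` inside `Fin 7`, as a row list. -/
def cubeRows : Fin 8 → Finset (Fin 7) := ![∅, {0}, {1}, {2}, {0, 1}, {0, 2}, {1, 2}, {0, 1, 2}]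

/-- The ball `B_1(7)`, as a column list. -/
def ballCols : Fin 8 → Finset (Fin 7) := ![∅, {0}, {1}, {2}, {3}, {4}, {5}, {6}]

/-- The five «diagonal» columns `∅, {3}, {4}, {5}, {6}`. -/
def diagCol : Fin 5 → Fin 8 := ![0, 4, 5, 6, 7]

/-- The layer indicators `f_d(i) = [|U_i| = d]`. -/
def layerVec (d : ℕ) : Fin 8 → ℂ := fun i => if (cubeRows i).card = d then 1 else 0

/-- The cube row list is injective. -/
theorem cubeRows_injective : Function.Injective cubeRows := by
  unfold cubeRows; decide +kernel

/-- The ball column list is injective. -/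
theorem ballCols_injective : Function.Injective ballCols := by
  unfold ballCols; decide +kernel

/-- The cube row list enumerates exactly the subsets of `{0, 1, 2}`. -/
theorem range_cubeRows (U : Finset (Fin 7)) : (∃ i, cubeRows i = U) ↔ U ⊆ {0, 1, 2} := by
  revert U; unfold cubeRows; decide +kernel

/-- The column list enumerates exactly the ball `B_1(7)`. -/
theorem range_ballCols (J : Finset (Fin 7)) : (∃ k, ballCols k = J) ↔ J.card ≤ 1 := by
  revert J; unfold ballCols; decide +kernel

/-- The cube rows form a down-set. -/
theorem isLowerSet_cubeRows : IsLowerSet (Set.range cubeRows) := by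
  intro U V hVU hU
  rw [Set.mem_range, range_cubeRows] at hU ⊢
  exact fun a ha => hU (hVU ha)

/-- A diagonal column `k = diagCol j` is `Σ_d s^d f_d` with `s = u(J_k)` (the states of `J_k` are outside the cube). -/
theorem col_diag_eq (u w : Fin 7 → ℂ) (j : Fin 5) :
    (jdPlusMatrix u w cubeRows ballCols).col (diagCol j) =
      ∑ d ∈ Finset.range 4, (∑ q ∈ ballCols (diagCol j), u q) ^ d • layerVec d := by
  ext i
  simp only [Matrix.col_apply, jdPlusMatrix, Matrix.of_apply, Finset.sum_apply, Pi.smul_apply, smul_eq_mul, layerVec,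
    mul_ite, mul_one, mul_zero]
  have hcard : (cubeRows i).card < 4 := by revert i; unfold cubeRows; decide +kernel
  have hmem : ∀ a ∈ cubeRows i, a ∉ ballCols (diagCol j) := by
    revert i j; unfold cubeRows ballCols diagCol; decide +kernel
  rw [Finset.prod_congr rfl (fun a ha => by rw [if_neg (hmem a ha), add_zero]), Finset.prod_const]
  rw [Finset.sum_eq_single (cubeRows i).card]
  · simp
  · intro d _ hd; rw [if_neg (Ne.symm hd)]
  · intro h; exact absurd (Finset.mem_range.mpr hcard) h

/-- ★ **`Stmt.conjDS 1` is false**: the down-set `2^{[3]}` against the ball `B_1(7)` has a singular JD⁺ matrix for ALL weights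
(the five diagonal columns lie in the 4-dimensional span of the layer indicators). -/
theorem not_conjDS_one : ¬ Stmt.conjDS 1 := by
  intro h
  obtain ⟨u, w, hdet⟩ := h 7 cubeRows ballCols cubeRows_injective isLowerSet_cubeRows ballCols_injective range_ballCols
  apply hdet
  set M := jdPlusMatrix u w cubeRows ballCols with hM
  by_contra hne
  have hunit : IsUnit M := (Matrix.isUnit_iff_isUnit_det M).mpr (isUnit_iff_ne_zero.mpr hne)
  have hli : LinearIndependent ℂ M.col := Matrix.linearIndependent_cols_iff_isUnit.mpr hunit
  have hli5 : LinearIndependent ℂ (fun j : Fin 5 => M.col (diagCol j)) :=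
    hli.comp diagCol (by unfold diagCol; decide +kernel)
  -- the five columns lie in the span of the four layer vectors
  set S : Submodule ℂ (Fin 8 → ℂ) := Submodule.span ℂ (Set.range fun d : Fin 4 => layerVec d.val) with hS
  have hmemS : ∀ j : Fin 5, M.col (diagCol j) ∈ S := by
    intro j
    rw [hM, col_diag_eq]
    refine Submodule.sum_mem _ fun d hd => Submodule.smul_mem _ _ (Submodule.subset_span ?_)
    exact ⟨⟨d, Finset.mem_range.mp hd⟩, rfl⟩
  have hli5' : LinearIndependent ℂ (fun j : Fin 5 => (⟨M.col (diagCol j), hmemS j⟩ : S)) := by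
    apply LinearIndependent.of_comp S.subtype
    exact hli5
  have h1 : Fintype.card (Fin 5) ≤ Module.finrank ℂ S := hli5'.fintype_card_le_finrank
  have h2 : Module.finrank ℂ S ≤ 4 := by
    rw [hS]
    calc Module.finrank ℂ (Submodule.span ℂ (Set.range fun d : Fin 4 => layerVec d.val))
        ≤ (Set.range fun d : Fin 4 => layerVec d.val).toFinset.card := finrank_span_le_card _
      _ ≤ Fintype.card (Fin 4) := by
          rw [Set.toFinset_range]; exact Finset.card_image_le.trans (by simp)
      _ = 4 := Fintype.card_fin 4
  rw [Fintype.card_fin] at h1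
  omega

end BallCut

end

end Summit.ValiantsHypothesis.ValiantsHypothesis.Theorems.BarrierLever.HiddenStates
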